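import Literature.Analysis.FluidPDE.CriticalSpaces
import Literature.Analysis.FunctionSpaces.BesovTranslation
import HarnessLib

/-!
# Spatial translates of vector fields and of their tempered distributions; zooming at a point

Analysis/FluidPDE proof file (theorems only: no definition, no named fact). Glue between the
vector-field side (`IsDistributionOf`, `rescaleData` of `CriticalSpaces.lean`) and the translation
operator `FunctionSpaces.distribTranslate` on `𝓢'` (`FunctionSpaces/BesovTranslation.lean`), as
used when a blow-up argument zooms in at a point `x₀ ≠ 0`
(`y ↦ λ u₀(x₀ + λ y)`; Escauriaza–Seregin–Šverák 2003, §3; Albritton 2018, §3 Step 1 "we may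
assume that the singularity occurs at the spatial origin"; Wang–Zhang 2017, §4 Step 1):

* `IsDistributionOf.translate` — the distribution of `x ↦ u₀(x - b)` is `τ_b U`;
* `IsDistributionOf.translate_add` — the distribution of `x ↦ u₀(x + x₀)` is `τ_{-x₀} U`;
* `IsDistributionOf.rescaleData_translate_add` — the distribution of the zoom
  `y ↦ c • u₀(x₀ + c • y)` is `rescaleDistrib c (τ_{-x₀} U)`;
* `eHomBesovNorm_zoom_eq` — on `ℝ³` its critical Besov norm is that of `U` for dyadic `c = 2^{j₀}`
  (translation invariance `eHomBesovNorm_distribTranslate` and the dyadic scaling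
  `eHomBesovNorm_rescaleData`), and `memHomBesov_zoom` for the class.

## References

* L. Escauriaza, G. Seregin, V. Šverák, Russ. Math. Surveys 58:2 (2003), §3 (the rescaling about
  `z₀`). [EscauriazaSereginSverak2003]
* D. Albritton, Anal. PDE 11 (2018) = arXiv:1612.04439, §3 Step 1. [Albritton2018]
* H. Bahouri, J.-Y. Chemin, R. Danchin, *Fourier Analysis and Nonlinear PDE* (2011), Prop. 2.18.
  [BahouriCheminDanchin2011]
-/

noncomputable section

open MeasureTheory Filter Set Function
open _root_.Topology
open scoped SchwartzMap ENNReal NNReal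

namespace Literature.Analysis.FluidPDE

open FunctionSpaces.EuclideanSpace (complexify)

section Translate

variable {ι : Type*} [Fintype ι] {E : Type*} [NormedAddCommGroup E] [InnerProductSpace ℝ E]
  [FiniteDimensional ℝ E] [MeasurableSpace E] [BorelSpace E]

/-- **The distribution of a translated field is the translated distribution**: if `U` is the
tempered distribution of `u₀ : E → ℝ^ι`, then `τ_b U` is the distribution of `x ↦ u₀(x - b)`
(`⟨τ_b U, φ⟩ = ⟨U, φ(· + b)⟩ = ∫ φ(x + b) u₀(x) dx = ∫ φ(x) u₀(x - b) dx`, translation invariance of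
the Haar integral). [cite: BahouriCheminDanchin2011, §1.2.1] -/
theorem IsDistributionOf.translate {u₀ : E → EuclideanSpace ℝ ι} {U : 𝓢'(E, EuclideanSpace ℂ ι)}
    (hU : IsDistributionOf u₀ U) (b : E) :
    IsDistributionOf (fun x => u₀ (x - b))
      (FunctionSpaces.distribTranslate (EuclideanSpace ℂ ι) b U) := by
  intro φ
  obtain ⟨hint, hUψ⟩ := hU (SchwartzMap.compSubConstCLM ℂ (-b) φ)
  have hint' : Integrable (fun x => φ x • complexify (u₀ (x - b))) := by
    have h := hint.comp_sub_right b
    refine h.congr (Eventually.of_forall fun x => ?_)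
    simp only [SchwartzMap.compSubConstCLM_apply, sub_neg_eq_add, sub_add_cancel]
  refine ⟨hint', ?_⟩
  rw [FunctionSpaces.distribTranslate_apply_apply, hUψ,
    ← integral_sub_right_eq_self
      (fun x => (SchwartzMap.compSubConstCLM ℂ (-b) φ) x • complexify (u₀ x)) b]
  refine integral_congr_ae (Eventually.of_forall fun x => ?_)
  simp only [SchwartzMap.compSubConstCLM_apply, sub_neg_eq_add, sub_add_cancel]

/-- The distribution of `x ↦ u₀(x + x₀)` is `τ_{-x₀} U`. [cite: BahouriCheminDanchin2011, §1.2.1] -/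
theorem IsDistributionOf.translate_add {u₀ : E → EuclideanSpace ℝ ι}
    {U : 𝓢'(E, EuclideanSpace ℂ ι)} (hU : IsDistributionOf u₀ U) (x₀ : E) :
    IsDistributionOf (fun x => u₀ (x + x₀))
      (FunctionSpaces.distribTranslate (EuclideanSpace ℂ ι) (-x₀) U) := by
  have h := hU.translate (-x₀)
  simp only [sub_neg_eq_add] at h
  exact h

end Translate

/-! ## Zooming in at a point of `ℝ³` -/

section Zoom

/-- **The distribution of the zoom `y ↦ c • u₀(x₀ + c • y)` at a point `x₀`** is
`rescaleDistrib c (τ_{-x₀} U)` (translation, then the Navier–Stokes rescaling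
`IsDistributionOf.rescaleData`). [cite: Albritton2018, §3 Step 1] -/
theorem IsDistributionOf.rescaleData_translate_add
    {u₀ : EuclideanSpace ℝ (Fin 3) → EuclideanSpace ℝ (Fin 3)}
    {U : 𝓢'(EuclideanSpace ℝ (Fin 3), EuclideanSpace ℂ (Fin 3))} (hU : IsDistributionOf u₀ U)
    (x₀ : EuclideanSpace ℝ (Fin 3)) (c : ℝˣ) :
    IsDistributionOf (fun y => (c : ℝ) • u₀ (x₀ + (c : ℝ) • y))
      (rescaleDistrib c
        (FunctionSpaces.distribTranslate (EuclideanSpace ℂ (Fin 3)) (-x₀) U)) := by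
  have h := (hU.translate_add x₀).rescaleData c
  refine fun φ => ?_
  have e : (fun y => (c : ℝ) • u₀ (x₀ + (c : ℝ) • y)) =
      FluidPDE.rescaleData (c : ℝ) fun x => u₀ (x + x₀) := by
    funext y
    simp only [rescaleData_apply, add_comm]
  rw [e]
  exact h φ

/-- **The critical Besov norm of the zoom at `x₀` by a dyadic factor is that of `U`**:
`‖2^{j₀} • (τ_{-x₀} U)(2^{j₀} ·)‖_{Ḃ^{-1+3/p}_{p,q}} = ‖U‖_{Ḃ^{-1+3/p}_{p,q}}` (translation
invariance, BCD Prop. 2.18, and the exact dyadic scaling `eHomBesovNorm_rescaleData`).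
[cite: BahouriCheminDanchin2011, Prop. 2.18] -/
theorem eHomBesovNorm_zoom_eq {F : Type*} [NormedAddCommGroup F] [NormedSpace ℂ F]
    [CompleteSpace F] (p q : ℝ≥0∞) [Fact (1 ≤ p)] (x₀ : EuclideanSpace ℝ (Fin 3)) (j₀ : ℤ)
    (U : 𝓢'(EuclideanSpace ℝ (Fin 3), F)) :
    FunctionSpaces.eHomBesovNorm (-1 + 3 / p.toReal) p q
        (rescaleDistrib (Units.mk0 ((2 : ℝ) ^ j₀) (zpow_ne_zero j₀ two_ne_zero))
          (FunctionSpaces.distribTranslate F (-x₀) U)) =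
      FunctionSpaces.eHomBesovNorm (-1 + 3 / p.toReal) p q U := by
  rw [eHomBesovNorm_rescaleData FunctionSpaces.eHomBesovNorm_distribDilate_holds,
    FunctionSpaces.eHomBesovNorm_distribTranslate]

/-- The zoom at `x₀` by a dyadic factor of a critical Besov distribution is a critical Besov
distribution. [cite: BahouriCheminDanchin2011, Prop. 2.18] -/
theorem memHomBesov_zoom {F : Type*} [NormedAddCommGroup F] [NormedSpace ℂ F] [CompleteSpace F]
    {p q : ℝ≥0∞} [Fact (1 ≤ p)] (x₀ : EuclideanSpace ℝ (Fin 3)) (j₀ : ℤ)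
    {U : 𝓢'(EuclideanSpace ℝ (Fin 3), F)}
    (hU : FunctionSpaces.MemHomBesov (-1 + 3 / p.toReal) p q U) :
    FunctionSpaces.MemHomBesov (-1 + 3 / p.toReal) p q
      (rescaleDistrib (Units.mk0 ((2 : ℝ) ^ j₀) (zpow_ne_zero j₀ two_ne_zero))
        (FunctionSpaces.distribTranslate F (-x₀) U)) :=
  memHomBesov_rescaleData FunctionSpaces.MemHomBesov.distribDilate_holds (hU.distribTranslate (-x₀)) j₀

end Zoom

end Literature.Analysis.FluidPDE

end
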